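import Summits.Ventures.Crystal3D.Theorems.StickyWulffConstantTextureLiminfTexShadowLevelReach
import Summits.Ventures.Crystal3D.Theorems.StickyWulffConstantTextureLiminfTexShadowLevelReachCutLemmas
import HarnessLib

/-!
# The cut launch census WITH THE END-PAIR SHAPE: the mover is the end ball's own class predecessor
# (lane T, crux `TextureLiminfV5`, stmt-Ventures-23912, registered stub `stub_terraceCensus`; (β) assembly — cross-family pooling)

HONEST FRAMING. Venture `Summits/Ventures/Crystal3D` (cell `crystal3d-full`), route `route-Ventures-StickyWulffConstant`, helper `--supports` the law-v5
crux `TextureLiminfV5` (stmt-Ventures-23912), lane T, mechanism (β).  Census-free, certificate-free; `KissingGap δ`, `KissingClassification δ` BY NAME; F-C1 not moved.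

THE POINT.  `word_family_endPairs_launch_cuts` (…LevelReachCutSet, p742856) VERBATIM — same hypotheses, same proof — with its fourth exported clause
«the invariant holds at the end ball for SOME class» strengthened to the LINKED form the global pooling needs: for every exported pair `(b, q)` there is ONE
well-formed class `κ` with `P (b, κ)`, `q = b − F κ (u κ)` (the mover is the end ball's predecessor IN THAT CLASS) and `¬ IsMoving X ver (F κ) (F κ (u κ)) b`.
For an all-cut census (`P` forcing `κ = []`) this says every end pair is a STRAIGHT root-class ending `q = b − F [] (u [])`, so end-pair families rooted in
different frames (rising bottom-plate lines vs falling top-plate lines, born lines) are disjoint by direction and can be pooled under ONE local row.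
**`word_family_endPairs_launch_cuts_shape`**.  WHAT THIS IS NOT: pooling itself, any bound on `#CUT`; F-C1 not moved.
-/

noncomputable section

namespace Summit.Ventures.Crystal3D.Theorems

open Summit.Ventures.Crystal3D Finset
open Literature.MathematicalPhysics.StatisticalMechanics (fccStacking)
open scoped InnerProductSpace

section Instance

variable {X : Finset (EuclideanSpace ℝ (Fin 3))}
  {F : List (EuclideanSpace ℝ (Fin 3)) → (EuclideanSpace ℝ (Fin 3) ≃ₗᵢ[ℝ] EuclideanSpace ℝ (Fin 3))}
  {u : List (EuclideanSpace ℝ (Fin 3)) → EuclideanSpace ℝ (Fin 3)}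
  {WF : List (EuclideanSpace ℝ (Fin 3)) → Prop}
  {next : List (EuclideanSpace ℝ (Fin 3)) → EuclideanSpace ℝ (Fin 3) → List (EuclideanSpace ℝ (Fin 3))}
  {P' P₂ : Finset (EuclideanSpace ℝ (Fin 3))} {R₀ h ρ : ℝ}

open scoped Classical in
/-- **The end pairs of one word family launched from `L` inside the window, CUT at the root-class readings of `(F [], F [] μ)` for every cut letter `μ`
(`C μ`).**  Hypotheses VERBATIM from `word_family_endPairs_launch_cut` except the cut predicate `C` (`hC : C μ → ⟪u [], μ⟫ = √(2/3)`) and `hPcross` required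
only off the cut (`κ ≠ [] ∨ ¬ C ((F []).symm m)`).  Conclusion: `#{launches stepping into the window} ≤ #T + #CUT + #{relaunched, straight or by a
cancelling-pair cross from [μ] with ¬ C μ} + 220·(#rim_top + #rim_bot)`, `T` with the same properties, the invariant clause in the LINKED form
`∃ κ, WF κ ∧ P (bq.1, κ) ∧ bq.2 = bq.1 − F κ (u κ) ∧ ¬ IsMoving X ver (F κ) (F κ (u κ)) bq.1`. -/
theorem word_family_endPairs_launch_cuts_shape (ver : WordVersion) {δ : ℝ} (hg : KissingGap δ) (hc : KissingClassification δ)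
    (hX : ∀ p ∈ X, ∀ q ∈ X, p ≠ q → 1 ≤ dist p q)
    (hFc : ∀ μ κ, F (μ :: κ) = ((ℝ ∙ μ)ᗮ.reflection).trans (F κ))
    (hu : ∀ κ, u κ ∈ fccSlots) (huc : ∀ μ κ, u (μ :: κ) = -u κ)
    (hWF0 : WF [])
    (hWFc : ∀ μ κ, WF (μ :: κ) ↔ (WF κ ∧ ‖μ‖ = 1 ∧
      (∀ w ∈ fccSlots, ⟪w, μ⟫_ℝ = 0 ∨ ⟪w, μ⟫_ℝ = Real.sqrt (2 / 3) ∨ ⟪w, μ⟫_ℝ = -Real.sqrt (2 / 3)) ∧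
      ⟪u κ, μ⟫_ℝ = Real.sqrt (2 / 3) ∧ ∀ μ' κ', κ = μ' :: κ' → μ' ≠ -μ))
    (hnext_pop : ∀ μ κ' (m : EuclideanSpace ℝ (Fin 3)), (F (μ :: κ')).symm m = -μ → next (μ :: κ') m = κ')
    (hnext_push : ∀ κ (m : EuclideanSpace ℝ (Fin 3)), (∀ μ κ', κ = μ :: κ' → (F κ).symm m ≠ -μ) →
      next κ m = (F κ).symm m :: κ)
    -- the CUT letters: each crossed upward by the root direction
    (C : EuclideanSpace ℝ (Fin 3) → Prop) (hC : ∀ μ, C μ → ⟪u [], μ⟫_ℝ = Real.sqrt (2 / 3))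
    -- the state invariant (preserved by LEGAL moves off the cut) and the top exclusion
    {P : EuclideanSpace ℝ (Fin 3) × List (EuclideanSpace ℝ (Fin 3)) → Prop}
    (hPstraight : ∀ (b : EuclideanSpace ℝ (Fin 3)) (κ : List (EuclideanSpace ℝ (Fin 3))), WF κ →
      (IsFull X (F κ) b ∨ (∃ m, IsTwinReading X (F κ) m b ∧ ⟪F κ (u κ), m⟫_ℝ = 0) ∨
        (ver = WordVersion.v2 ∧ IsNarrow X (F κ) (F κ (u κ)) b)) →
      P (b, κ) → P (b + F κ (u κ), κ))
    (hPcross : ∀ (b : EuclideanSpace ℝ (Fin 3)) (κ : List (EuclideanSpace ℝ (Fin 3))) (m : EuclideanSpace ℝ (Fin 3)),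
      WF κ → WF (next κ m) → IsTwinReading X (F κ) m b → ⟪F κ (u κ), m⟫_ℝ = Real.sqrt (2 / 3) →
      (κ ≠ [] ∨ ¬ C ((F []).symm m)) →
      P (b, κ) → P (b + F (next κ m) (u (next κ m)), next κ m))
    (hPexcl0 : ∀ (b : EuclideanSpace ℝ (Fin 3)) (κ : List (EuclideanSpace ℝ (Fin 3))), WF κ → P (b, κ) → b ∈ P₂ →
      (∃ a ∈ fccSlots, ∃ a' ∈ fccSlots, ∃ a'' ∈ fccSlots,
        ⟪a, a'⟫_ℝ = 1 / 2 ∧ ⟪a, a''⟫_ℝ = 1 / 2 ∧ ⟪a', a''⟫_ℝ = 1 / 2 ∧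
        b + F κ a ∈ X ∧ b + F κ a' ∈ X ∧ b + F κ a'' ∈ X) → False)
    (hup : 0 < (F [] (u [])) 2) (hR₀ : 3 ≤ R₀) (hρ : R₀ ≤ ρ)
    -- the LAUNCH SET: legal moving root states, first step off the launch set, invariant started at the first step
    (L : Finset (EuclideanSpace ℝ (Fin 3)))
    (hLsrc : ∀ p ∈ L, p ∈ X ∧
      (∃ a ∈ fccSlots, ∃ a' ∈ fccSlots, ∃ a'' ∈ fccSlots,
        ⟪a, a'⟫_ℝ = 1 / 2 ∧ ⟪a, a''⟫_ℝ = 1 / 2 ∧ ⟪a', a''⟫_ℝ = 1 / 2 ∧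
        p + F [] a ∈ X ∧ p + F [] a' ∈ X ∧ p + F [] a'' ∈ X) ∧
      p - F [] (u []) ∈ X ∧
      (IsFull X (F []) p ∨ (∃ m, IsTwinReading X (F []) m p ∧ ⟪F [] (u []), m⟫_ℝ = 0) ∨
        (ver = WordVersion.v2 ∧ IsNarrow X (F []) (F [] (u [])) p)) ∧
      P (p + F [] (u []), []))
    (hLstep : ∀ p ∈ L, p + F [] (u []) ∉ L)
    (hP'top : ∀ p ∈ P', p 2 ≤ -R₀ - 1)
    (hstd : ∀ κ, WF κ → ∀ p ∈ P', (∃ a ∈ fccSlots, ∃ a' ∈ fccSlots, ∃ a'' ∈ fccSlots,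
        ⟪a, a'⟫_ℝ = 1 / 2 ∧ ⟪a, a''⟫_ℝ = 1 / 2 ∧ ⟪a', a''⟫_ℝ = 1 / 2 ∧
        p + F κ a ∈ X ∧ p + F κ a' ∈ X ∧ p + F κ a'' ∈ X) → F κ (u κ) = F [] (u []))
    (hsealB : ∀ s ∈ X, s ∉ P' → -R₀ - 1 - 1 ≤ s 2 → s 2 < -R₀ - 1 → s 0 ^ 2 + s 1 ^ 2 ≤ (ρ - 1) ^ 2 → False)
    (hP₂seal : ∀ s ∈ X, h + R₀ + 1 ≤ s 2 → s 2 ≤ h + R₀ + 1 + 1 → s 0 ^ 2 + s 1 ^ 2 ≤ (ρ - 2) ^ 2 → s ∈ P₂) :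
    ∃ T : Finset (EuclideanSpace ℝ (Fin 3) × EuclideanSpace ℝ (Fin 3)),
      (L.filter fun p => -R₀ - 1 < (p + F [] (u [])) 2 ∧ (p + F [] (u [])) 2 < h + R₀ + 1).card ≤
        T.card +
        (X.filter fun b => -R₀ - 1 ≤ b 2 ∧ b 2 < h + R₀ + 1 ∧ (∃ μ, C μ ∧ IsTwinReading X (F []) (F [] μ) b) ∧ P (b, []) ∧
            b - F [] (u []) ∈ X).card +
        (L.filter fun p => P (p - F [] (u []), []) ∧
            -R₀ - 1 ≤ (p - F [] (u [])) 2 ∧ (p - F [] (u [])) 2 < h + R₀ + 1 ∧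
            (IsFull X (F []) (p - F [] (u [])) ∨
              (∃ m, IsTwinReading X (F []) m (p - F [] (u [])) ∧ ⟪F [] (u []), m⟫_ℝ = 0) ∨
              (ver = WordVersion.v2 ∧ IsNarrow X (F []) (F [] (u [])) (p - F [] (u [])))) ∨
          ∃ μ, WF [μ] ∧ ¬ C μ ∧ P (p - F [] (u []), [μ]) ∧
            -R₀ - 1 ≤ (p - F [] (u [])) 2 ∧ (p - F [] (u [])) 2 < h + R₀ + 1 ∧
            ∃ m, IsTwinReading X (F [μ]) m (p - F [] (u [])) ∧
              ⟪F [μ] (u [μ]), m⟫_ℝ = Real.sqrt (2 / 3) ∧ next [μ] m = []).card +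
        220 * (X.filter fun s => h + R₀ + 1 ≤ s 2 ∧ s 2 ≤ h + R₀ + 1 + 1 ∧ (ρ - 2) ^ 2 < s 0 ^ 2 + s 1 ^ 2).card +
        220 * (X.filter fun s => -R₀ - 1 - 1 ≤ s 2 ∧ s 2 < -R₀ - 1 ∧ (ρ - 1) ^ 2 < s 0 ^ 2 + s 1 ^ 2).card ∧
      (∀ bq ∈ T, bq.1 ∈ X ∧ bq.2 ∈ X ∧ dist bq.1 bq.2 = 1 ∧ -R₀ - 1 ≤ bq.1 2 ∧ bq.1 2 < h + R₀ + 1) ∧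
      (∀ bq ∈ T, (X.filter fun q => dist bq.1 q = 1).card ≤ 11 ∨
        ∃ z₁ ∈ X, ∃ z₂ ∈ X, z₁ ≠ z₂ ∧ dist bq.1 z₁ = 1 ∧ dist bq.1 z₂ = 1 ∧
          (X.filter fun q => dist z₁ q = 1).card ≤ 11 ∧ (X.filter fun q => dist z₂ q = 1).card ≤ 11) ∧
      (∀ bq ∈ T, ∃ κ, WF κ ∧ P (bq.1, κ) ∧ bq.2 = bq.1 - F κ (u κ) ∧ ¬ IsMoving X ver (F κ) (F κ (u κ)) bq.1) ∧
      (∀ bq ∈ T, ∃ κ, WF κ ∧ bq.2 - F κ (u κ) ∈ X ∧ IsEndMove X ver (F κ) (F κ (u κ)) bq.2 bq.1) := by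
  have hr : 0 < Real.sqrt (2 / 3) := Real.sqrt_pos.2 (by norm_num)
  -- the class data on the subtype of well-formed words
  set F' : {κ : List (EuclideanSpace ℝ (Fin 3)) // WF κ} →
      (EuclideanSpace ℝ (Fin 3) ≃ₗᵢ[ℝ] EuclideanSpace ℝ (Fin 3)) := fun κ => F κ.1 with hF'
  set d' : {κ : List (EuclideanSpace ℝ (Fin 3)) // WF κ} → EuclideanSpace ℝ (Fin 3) := fun κ => F κ.1 (u κ.1) with hd'
  set next' : {κ : List (EuclideanSpace ℝ (Fin 3)) // WF κ} → EuclideanSpace ℝ (Fin 3) →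
      {κ : List (EuclideanSpace ℝ (Fin 3)) // WF κ} := fun κ m =>
    @dite _ (WF (next κ.1 m)) (Classical.propDecidable _) (fun hw => ⟨next κ.1 m, hw⟩) (fun _ => κ) with hnext'
  set root : {κ : List (EuclideanSpace ℝ (Fin 3)) // WF κ} := ⟨[], hWF0⟩ with hroot_def
  have hdnC : ∀ μ, C μ → ⟪F [] (u []), F [] μ⟫_ℝ = Real.sqrt (2 / 3) := fun μ hμ => by rw [LinearIsometryEquiv.inner_map_map, hC μ hμ]
  have hspec : ∀ (κ : {κ : List (EuclideanSpace ℝ (Fin 3)) // WF κ}) (m : EuclideanSpace ℝ (Fin 3)), ‖m‖ = 1 →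
      (∀ w ∈ fccSlots, ⟪F' κ w, m⟫_ℝ = 0 ∨ ⟪F' κ w, m⟫_ℝ = Real.sqrt (2 / 3) ∨ ⟪F' κ w, m⟫_ℝ = -Real.sqrt (2 / 3)) →
      ⟪d' κ, m⟫_ℝ = Real.sqrt (2 / 3) →
      (next' κ m).1 = next κ.1 m ∧ (∀ x, F (next κ.1 m) x = F κ.1 x - (2 * ⟪F κ.1 x, m⟫_ℝ) • m) ∧
        ⟪F (next κ.1 m) (u (next κ.1 m)), m⟫_ℝ = Real.sqrt (2 / 3) ∧ next (next κ.1 m) m = κ.1 := by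
    intro κ m hm hmenu hdm
    obtain ⟨hwf, hfr, hdir, hinv⟩ := word_next_spec hFc huc hWFc hnext_pop hnext_push κ.2 hm hmenu hdm
    exact ⟨by simp only [hnext']; rw [dif_pos hwf], hfr, hdir, hinv⟩
  have hmirror : ∀ (κ : {κ : List (EuclideanSpace ℝ (Fin 3)) // WF κ}) (m : EuclideanSpace ℝ (Fin 3)), ‖m‖ = 1 →
      (∀ w ∈ fccSlots, ⟪F' κ w, m⟫_ℝ = 0 ∨ ⟪F' κ w, m⟫_ℝ = Real.sqrt (2 / 3) ∨ ⟪F' κ w, m⟫_ℝ = -Real.sqrt (2 / 3)) →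
      ⟪d' κ, m⟫_ℝ = Real.sqrt (2 / 3) → ∀ x, F' (next' κ m) x = F' κ x - (2 * ⟪F' κ x, m⟫_ℝ) • m := by
    intro κ m hm hmenu hdm x
    show F (next' κ m).1 x = F κ.1 x - (2 * ⟪F κ.1 x, m⟫_ℝ) • m; rw [(hspec κ m hm hmenu hdm).1]; exact (hspec κ m hm hmenu hdm).2.1 x
  have hinv : ∀ (κ : {κ : List (EuclideanSpace ℝ (Fin 3)) // WF κ}) (m : EuclideanSpace ℝ (Fin 3)), ‖m‖ = 1 →
      (∀ w ∈ fccSlots, ⟪F' κ w, m⟫_ℝ = 0 ∨ ⟪F' κ w, m⟫_ℝ = Real.sqrt (2 / 3) ∨ ⟪F' κ w, m⟫_ℝ = -Real.sqrt (2 / 3)) →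
      ⟪d' κ, m⟫_ℝ = Real.sqrt (2 / 3) → next' (next' κ m) m = κ := by
    intro κ m hm hmenu hdm
    obtain ⟨h1, -, -, hback⟩ := hspec κ m hm hmenu hdm
    apply Subtype.ext
    have h2 : (next' (next' κ m) m).1 = next (next' κ m).1 m := by
      simp only [hnext']; rw [dif_pos]; rw [h1, hback]; exact κ.2
    rw [h2, h1, hback]
  have hdnext : ∀ (κ : {κ : List (EuclideanSpace ℝ (Fin 3)) // WF κ}) (m : EuclideanSpace ℝ (Fin 3)), ‖m‖ = 1 →
      (∀ w ∈ fccSlots, ⟪F' κ w, m⟫_ℝ = 0 ∨ ⟪F' κ w, m⟫_ℝ = Real.sqrt (2 / 3) ∨ ⟪F' κ w, m⟫_ℝ = -Real.sqrt (2 / 3)) →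
      ⟪d' κ, m⟫_ℝ = Real.sqrt (2 / 3) → ⟪d' (next' κ m), m⟫_ℝ = Real.sqrt (2 / 3) := by
    intro κ m hm hmenu hdm
    show ⟪F (next' κ m).1 (u (next' κ m).1), m⟫_ℝ = Real.sqrt (2 / 3); rw [(hspec κ m hm hmenu hdm).1]; exact (hspec κ m hm hmenu hdm).2.2.1
  have hd : ∀ κ : {κ : List (EuclideanSpace ℝ (Fin 3)) // WF κ}, ∃ u' ∈ fccSlots, d' κ = F' κ u' := fun κ => ⟨u κ.1, hu κ.1, rfl⟩
  have hdn : ∀ κ : {κ : List (EuclideanSpace ℝ (Fin 3)) // WF κ}, ∃ m : EuclideanSpace ℝ (Fin 3), ‖m‖ = 1 ∧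
      (∀ w ∈ fccSlots, ⟪F' κ w, m⟫_ℝ = 0 ∨ ⟪F' κ w, m⟫_ℝ = Real.sqrt (2 / 3) ∨ ⟪F' κ w, m⟫_ℝ = -Real.sqrt (2 / 3)) ∧
      ⟪d' κ, m⟫_ℝ = Real.sqrt (2 / 3) := fun κ => exists_menuNormal_far (F κ.1) (hu κ.1)
  have hinjK : ∀ κ κ' : {κ : List (EuclideanSpace ℝ (Fin 3)) // WF κ},
      (F' κ : EuclideanSpace ℝ (Fin 3) → EuclideanSpace ℝ (Fin 3)) '' ↑fccSlots =
      (F' κ' : EuclideanSpace ℝ (Fin 3) → EuclideanSpace ℝ (Fin 3)) '' ↑fccSlots → κ = κ' :=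
    fun κ κ' himg => Subtype.ext (word_eq_of_image_eq hFc huc hWFc κ.2 κ'.2 himg)
  have hdinj : ∀ κ κ' : {κ : List (EuclideanSpace ℝ (Fin 3)) // WF κ}, d' κ = d' κ' → κ = κ' :=
    fun κ κ' hdd => Subtype.ext (word_dir_injective hFc huc hWFc (hu []) κ.2 κ'.2 hdd)
  obtain ⟨W, hW, hmult⟩ := exists_certified_states (F := F') (d := d') hX hinjK
  obtain ⟨f, hf_full, hf_cross, hf_glide, hf_narrow⟩ := exists_word_move_map_gen X F' d' next' hd
  have htarget : ∀ v ∈ W, IsMoving X ver (F' v.2) (d' v.2) v.1 →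
      f v ∈ W ∧ (f v).1 - d' (f v).2 = v.1 ∧ dist v.1 (f v).1 = 1 :=
    fun v hv hm => word_move_target_gen ver hd hdn hmirror hdnext hW (fun v _ => hf_full v)
      (fun v _ m => hf_cross v m) (fun v _ m => hf_glide v m) (fun v _ _ hn => hf_narrow v hn) hv hm
  have hinjW : Set.InjOn f {v | v ∈ W ∧ IsMoving X ver (F' v.2) (d' v.2) v.1} :=
    word_move_injOn_gen ver hX hd hmirror hinv hdnext (fun v hv => ((hW v).1 hv).2.2) (fun v _ => hf_full v)
      (fun v _ m => hf_cross v m) (fun v _ m => hf_glide v m) (fun v _ _ hn => hf_narrow v hn)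
  -- the CUT moving predicate: legal moves, except from a root-class reading of a cut letter's twin
  set mov : EuclideanSpace ℝ (Fin 3) × {κ : List (EuclideanSpace ℝ (Fin 3)) // WF κ} → Prop :=
    fun v => IsMoving X ver (F' v.2) (d' v.2) v.1 ∧ ¬ (v.2 = root ∧ ∃ μ, C μ ∧ IsTwinReading X (F []) (F [] μ) v.1) with hmovdef
  have htarget' : ∀ v ∈ W, mov v → f v ∈ W ∧ (f v).1 - d' (f v).2 = v.1 ∧ dist v.1 (f v).1 = 1 := fun v hv hm => htarget v hv hm.1
  have hinjW' : Set.InjOn f {v | v ∈ W ∧ mov v} := fun x hx y hy hxy => hinjW ⟨hx.1, hx.2.1⟩ ⟨hy.1, hy.2.1⟩ hxy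
  -- the invariant, lifted to the subtype of well-formed words, along moves: `P` AND «the class does not end in a cut letter»
  set Pw : EuclideanSpace ℝ (Fin 3) × {κ : List (EuclideanSpace ℝ (Fin 3)) // WF κ} → Prop :=
    fun v => P (v.1, v.2.1) ∧ ∀ μ, C μ → v.2.1.getLast? ≠ some μ with hPwdef
  have hsrc : ∀ p ∈ L, (p, root) ∈ W ∧ mov (p, root) ∧ f (p, root) = (p + d' root, root) ∧ Pw (p + d' root, root) := by
    intro p hp
    obtain ⟨hpX, htri, hpred, hmv, hP⟩ := hLsrc p hp
    have hW' : (p, root) ∈ W := (hW _).2 ⟨hpX, htri, hpred⟩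
    have hnc : ¬ ((p, root).2 = root ∧ ∃ μ, C μ ∧ IsTwinReading X (F []) (F [] μ) (p, root).1) :=
      fun ⟨_, μ, hμ, hread⟩ => not_isTwinReading_of_straightMover ver (F []) (hu []) (hdnC μ hμ) hmv hread
    have hPw : Pw (p + d' root, root) := ⟨hP, fun μ _ => by simp [hroot_def]⟩
    rcases hmv with hfull | ⟨m, htd, h0⟩ | ⟨hver, hnar⟩
    · exact ⟨hW', ⟨Or.inl hfull, hnc⟩, hf_full (p, root) hfull, hPw⟩
    · exact ⟨hW', ⟨Or.inr (Or.inl ⟨m, htd, Or.inr h0⟩), hnc⟩, hf_glide (p, root) m htd h0, hPw⟩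
    · exact ⟨hW', ⟨Or.inr (Or.inr ⟨hver, hnar⟩), hnc⟩, hf_narrow (p, root) hnar, hPw⟩
  have hLstep' : ∀ p ∈ L, p + d' root ∉ L := fun p hp => hLstep p hp
  have hPmov : ∀ v ∈ W, mov v → Pw v → Pw (f v) := by
    rintro v - ⟨hmv, hnc⟩ ⟨hPv, hlast⟩
    rcases hmv with hfull | ⟨m, htd, hdm⟩ | ⟨hver, hnar⟩
    · rw [hf_full v hfull]; exact ⟨hPstraight v.1 v.2.1 v.2.2 (Or.inl hfull) hPv, hlast⟩
    · rcases hdm with hdm | hdm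
      · rw [hf_cross v m htd hdm]
        obtain ⟨h1, -, -, -⟩ := hspec v.2 m htd.1.1 htd.1.2 hdm
        have hwf : WF (next v.2.1 m) := by rw [← h1]; exact (next' v.2 m).2
        have hoff : v.2.1 ≠ [] ∨ ¬ C ((F []).symm m) := by
          refine Classical.or_iff_not_imp_left.2 fun hnil hCm => hnc ⟨Subtype.ext (by simpa using hnil), (F []).symm m, hCm, ?_⟩
          have htd' : IsTwinReading X (F v.2.1) m v.1 := htd
          rw [show F v.2.1 = F [] by rw [show v.2.1 = [] by simpa using hnil]] at htd'
          rw [LinearIsometryEquiv.apply_symm_apply]; exact htd'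
        have hoffμ : ∀ μ, C μ → v.2.1 ≠ [] ∨ m ≠ F [] μ := fun μ hμ => hoff.imp_right fun h' hm => h' (by rw [hm, LinearIsometryEquiv.symm_apply_apply]; exact hμ)
        refine ⟨?_, ?_⟩
        · show P ((v.1 + F (next' v.2 m).1 (u (next' v.2 m).1), (next' v.2 m).1))
          rw [h1]; exact hPcross v.1 v.2.1 m v.2.2 hwf htd hdm hoff hPv
        · show ∀ μ, C μ → (next' v.2 m).1.getLast? ≠ some μ
          intro μ hμ; rw [h1]; exact word_next_getLast_ne hnext_pop hnext_push v.2.1 m (hlast μ hμ) (hoffμ μ hμ)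
      · rw [hf_glide v m htd hdm]; exact ⟨hPstraight v.1 v.2.1 v.2.2 (Or.inr (Or.inl ⟨m, htd, hdm⟩)) hPv, hlast⟩
    · rw [hf_narrow v hnar]; exact ⟨hPstraight v.1 v.2.1 v.2.2 (Or.inr (Or.inr ⟨hver, hnar⟩)) hPv, hlast⟩
  have hnoReentry : ∀ v ∈ W, mov v → Pw v → -R₀ - 1 ≤ v.1 2 → v.1 2 < h + R₀ + 1 → (f v).1 ∉ P' := by
    intro v hvW hm _ hlo _ hP'
    obtain ⟨hfW, hback, -⟩ := htarget v hvW hm.1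
    obtain ⟨-, htri, -⟩ := (hW (f v)).1 hfW
    have hdir : d' (f v).2 = d' root := hstd (f v).2.1 (f v).2.2 (f v).1 hP' htri
    have hv1 : v.1 = (f v).1 - d' root := by rw [← hdir, hback]
    have h2 : v.1 2 = (f v).1 2 - (F [] (u [])) 2 := by rw [hv1]; rfl
    linarith [hP'top _ hP']
  have hsealT : ∀ v ∈ W, mov v → Pw v → -R₀ - 1 ≤ v.1 2 → v.1 2 < h + R₀ + 1 →
      h + R₀ + 1 ≤ (f v).1 2 → (f v).1 2 ≤ h + R₀ + 1 + 1 → (f v).1 0 ^ 2 + (f v).1 1 ^ 2 ≤ (ρ - 2) ^ 2 → False := by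
    intro v hvW hm hPv _ _ hge hle hlat
    obtain ⟨hfW, -, -⟩ := htarget v hvW hm.1
    obtain ⟨hfX, htri, -⟩ := (hW (f v)).1 hfW
    exact hPexcl0 (f v).1 (f v).2.1 (f v).2.2 (hPmov v hvW hm hPv).1 (hP₂seal _ hfX hge hle hlat) htri
  -- the abstract exact count from the launch set, plates abstracted, with the CUT moving predicate
  have key := word_sources_le_exact_launch_cell mov L (root := root)
    (P := Pw) hW hmult htarget' hinjW' hsrc hLstep' hPmov hnoReentry hR₀ hρ hP'top hsealB hsealT
  obtain ⟨E, RL, hkey, hEmem, hRLmem⟩ :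
      ∃ (E : Finset (EuclideanSpace ℝ (Fin 3) × {κ : List (EuclideanSpace ℝ (Fin 3)) // WF κ})) (RL : Finset (EuclideanSpace ℝ (Fin 3))),
      (L.filter fun p => -R₀ - 1 < (p + F [] (u [])) 2 ∧ (p + F [] (u [])) 2 < h + R₀ + 1).card ≤ E.card + RL.card +
        220 * (X.filter fun s => h + R₀ + 1 ≤ s 2 ∧ s 2 ≤ h + R₀ + 1 + 1 ∧ (ρ - 2) ^ 2 < s 0 ^ 2 + s 1 ^ 2).card +
        220 * (X.filter fun s => -R₀ - 1 - 1 ≤ s 2 ∧ s 2 < -R₀ - 1 ∧ (ρ - 1) ^ 2 < s 0 ^ 2 + s 1 ^ 2).card ∧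
      (∀ v, v ∈ E ↔ v ∈ W ∧ (-R₀ - 1 ≤ v.1 2 ∧ v.1 2 < h + R₀ + 1 ∧ ¬ mov v ∧ Pw v ∧ ∃ u ∈ W, mov u ∧ f u = v)) ∧
      (∀ p, p ∈ RL ↔ p ∈ L ∧ ∃ v ∈ W, mov v ∧ Pw v ∧ -R₀ - 1 ≤ v.1 2 ∧ v.1 2 < h + R₀ + 1 ∧ f v = (p, root)) :=
    ⟨_, _, key, fun v => by simp only [Finset.mem_filter], fun p => by simp only [Finset.mem_filter]⟩
  set E₁ := E.filter fun v => ¬ IsMoving X ver (F' v.2) (d' v.2) v.1 with hE₁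
  set E₂ := E.filter fun v => IsMoving X ver (F' v.2) (d' v.2) v.1 with hE₂
  have hEsplit : E.card = E₁.card + E₂.card := by
    rw [hE₁, hE₂, add_comm]; exact (card_filter_add_card_filter_not _).symm
  have hE₁mem : ∀ v, v ∈ E₁ → v ∈ W ∧ -R₀ - 1 ≤ v.1 2 ∧ v.1 2 < h + R₀ + 1 ∧ ¬ IsMoving X ver (F' v.2) (d' v.2) v.1 ∧
      Pw v ∧ ∃ u ∈ W, mov u ∧ f u = v := fun v hv => by
    obtain ⟨hvW, h1, h2, -, hP, hreach⟩ := (hEmem v).1 (mem_filter.1 hv).1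
    exact ⟨hvW, h1, h2, (mem_filter.1 hv).2, hP, hreach⟩
  -- the END PAIRS: (end ball, predecessor ball); distinct ends give distinct pairs by direction injectivity
  set T : Finset (EuclideanSpace ℝ (Fin 3) × EuclideanSpace ℝ (Fin 3)) := E₁.image fun v => (v.1, v.1 - d' v.2) with hT
  have hTcard : T.card = E₁.card := by
    refine Finset.card_image_of_injOn fun v₁ _ v₂ _ heq => ?_
    obtain ⟨h1, h2⟩ := Prod.mk.inj heq
    have hdd : d' v₁.2 = d' v₂.2 := by have := h2; rw [h1] at this; exact sub_right_injective this
    exact Prod.ext h1 (hdinj _ _ hdd)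
  refine ⟨T, ?_, ?_, ?_, ?_, ?_⟩
  · rw [hTcard]
    rw [hEsplit] at hkey
    refine hkey.trans (Nat.add_le_add_right (Nat.add_le_add_right (Nat.add_le_add (Nat.add_le_add_left ?_ _) ?_) _) _)
    · -- the CUT states are root-class readings of a cut letter's twin reached by a root line; at most one per ball
      refine card_le_card_of_injOn (fun v => v.1) (fun v hv => ?_) ?_
      · obtain ⟨hvE, hmv⟩ := mem_filter.1 hv
        obtain ⟨hvW, h1, h2, hnm, hP, w', hw'W, hw'm, hfw'⟩ := (hEmem v).1 hvE
        have hcutv : v.2 = root ∧ ∃ μ, C μ ∧ IsTwinReading X (F []) (F [] μ) v.1 := by by_contra hno; exact hnm ⟨hmv, hno⟩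
        obtain ⟨hv2, hread⟩ := hcutv
        obtain ⟨-, hback, -⟩ := htarget w' hw'W hw'm.1
        rw [hfw'] at hback
        have hpredX : v.1 - F [] (u []) ∈ X := by
          have e : v.1 - F [] (u []) = w'.1 := by rw [← hback, hv2]
          rw [e]; exact ((hW w').1 hw'W).1
        have hPv : P (v.1, []) := by have := hP.1; rw [hv2] at this; exact this
        exact mem_filter.2 ⟨((hW v).1 hvW).1, h1, h2, hread, hPv, hpredX⟩
      · intro v₁ hv₁ v₂ hv₂ heq
        have hroot : ∀ v : EuclideanSpace ℝ (Fin 3) × {κ : List (EuclideanSpace ℝ (Fin 3)) // WF κ}, v ∈ (E₂ : Set _) → v.2 = root :=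
          fun v hv => by
          have h' := mem_filter.1 (Finset.mem_coe.1 hv)
          by_contra hno; exact ((hEmem v).1 h'.1).2.2.2.1 ⟨h'.2, fun h'' => hno h''.1⟩
        exact Prod.ext heq (by rw [hroot v₁ hv₁, hroot v₂ hv₂])
    · -- the RELAUNCH set in geometric form (the cross letter is uncut)
      refine card_le_card fun p hp => ?_
      rw [mem_filter]
      obtain ⟨hpL, v, hvW, hm, hPv, hlo, hhi, hfv⟩ := (hRLmem p).1 hp
      refine ⟨hpL, ?_⟩
      obtain ⟨-, hback, -⟩ := htarget v hvW hm.1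
      rw [hfv] at hback
      have hv1 : v.1 = p - F [] (u []) := by rw [← hback]
      have hlo' : -R₀ - 1 ≤ (p - F [] (u [])) 2 := by rw [← hv1]; exact hlo
      have hhi' : (p - F [] (u [])) 2 < h + R₀ + 1 := by rw [← hv1]; exact hhi
      have hPv' : P (v.1, v.2.1) := hPv.1
      have hlast : ∀ μ, C μ → v.2.1.getLast? ≠ some μ := hPv.2
      rcases hm.1 with hfull | ⟨m, htd, hdm⟩ | ⟨hver, hnar⟩
      · -- straight from a full shell: the class is the root class
        have hf := hf_full v hfull
        rw [hf] at hfv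
        have hv2 : v.2 = root := (Prod.mk.inj hfv).2
        have hfull' : IsFull X (F v.2.1) v.1 := hfull
        rw [hv1, hv2] at hfull' hPv'
        exact Or.inl ⟨hPv', hlo', hhi', Or.inl hfull'⟩
      · rcases hdm with hcr | hgl
        · -- a cross popping to the root class: the class is a one-letter class `[μ]`, `μ` uncut
          have hf := hf_cross v m htd hcr
          rw [hf] at hfv
          have hnx : next' v.2 m = root := (Prod.mk.inj hfv).2
          obtain ⟨h1, -, -, -⟩ := hspec v.2 m htd.1.1 htd.1.2 hcr
          have hnil : next v.2.1 m = [] := by rw [← h1]; exact congrArg Subtype.val hnx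
          obtain ⟨μ, hμ⟩ : ∃ μ, v.2.1 = [μ] := word_next_eq_nil hnext_pop hnext_push hnil
          have hwf : WF [μ] := by rw [← hμ]; exact v.2.2
          have hne : ¬ C μ := fun hCμ => hlast μ hCμ (by rw [hμ, List.getLast?_singleton])
          have htd' : IsTwinReading X (F v.2.1) m v.1 := htd
          have hcr' : ⟪F v.2.1 (u v.2.1), m⟫_ℝ = Real.sqrt (2 / 3) := hcr
          rw [hv1, hμ] at htd' hPv'; rw [hμ] at hcr' hnil
          exact Or.inr ⟨μ, hwf, hne, hPv', hlo', hhi', m, htd', hcr', hnil⟩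
        · -- a glide: the class is the root class
          have hf := hf_glide v m htd hgl
          rw [hf] at hfv
          have hv2 : v.2 = root := (Prod.mk.inj hfv).2
          have htd' : IsTwinReading X (F v.2.1) m v.1 := htd
          have hgl' : ⟪F v.2.1 (u v.2.1), m⟫_ℝ = 0 := hgl
          rw [hv1, hv2] at htd' hPv'; rw [hv2] at hgl'
          exact Or.inl ⟨hPv', hlo', hhi', Or.inr (Or.inl ⟨m, htd', hgl'⟩)⟩
      · -- narrow (version `v2`): the class is the root class
        have hf := hf_narrow v hnar
        rw [hf] at hfv
        have hv2 : v.2 = root := (Prod.mk.inj hfv).2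
        have hnar' : IsNarrow X (F v.2.1) (F v.2.1 (u v.2.1)) v.1 := hnar
        rw [hv1, hv2] at hnar' hPv'
        exact Or.inl ⟨hPv', hlo', hhi', Or.inr (Or.inr ⟨hver, hnar'⟩)⟩
  · -- balls, contact, window
    intro bq hbq
    obtain ⟨v, hv, rfl⟩ := mem_image.1 hbq
    obtain ⟨hvW, h1, h2, -, -, -⟩ := hE₁mem v hv
    obtain ⟨hbX, -, hpred⟩ := (hW v).1 hvW
    obtain ⟨u', hu', hdu⟩ := hd v.2
    refine ⟨hbX, hpred, ?_, h1, h2⟩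
    show dist v.1 (v.1 - d' v.2) = 1
    rw [dist_eq_norm, sub_sub_cancel, hdu, LinearIsometryEquiv.norm_map, norm_eq_one_of_mem_fccSlots hu']
  · -- the two-payer dichotomy
    intro bq hbq
    obtain ⟨v, hv, rfl⟩ := mem_image.1 hbq
    obtain ⟨hvW, -, -, hnm, -, -⟩ := hE₁mem v hv
    obtain ⟨hnf, hnt⟩ := not_full_not_twin_of_not_isMoving hnm
    exact certified_end_two_payers hg hc hX hd hW hvW hnf hnt
  · -- the invariant at the end ball, LINKED: the mover is the end ball's own class predecessor, the end ball is not moving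
    intro bq hbq
    obtain ⟨v, hv, rfl⟩ := mem_image.1 hbq
    obtain ⟨-, -, -, hnm, hP, -⟩ := hE₁mem v hv
    exact ⟨v.2.1, v.2.2, hP.1, rfl, hnm⟩
  · -- the moving predecessor and the non-moving target: `IsEndMove`
    intro bq hbq
    obtain ⟨v, hv, rfl⟩ := mem_image.1 hbq
    obtain ⟨-, -, -, hnm, -, u', hu'W, ⟨hum, -⟩, hfu⟩ := hE₁mem v hv
    obtain ⟨-, hback, -⟩ := htarget u' hu'W hum
    rw [hfu] at hback
    obtain ⟨-, -, hpredu⟩ := (hW u').1 hu'W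
    have hpair : (v.1, v.1 - d' v.2) = ((f u').1, u'.1) := by rw [← hback, hfu]
    have hv1 : v.1 = (f u').1 := by rw [hfu]
    rw [hpair]; refine ⟨u'.2.1, u'.2.2, hpredu, ?_⟩
    have hnm' : ¬ IsMoving X ver (F v.2.1) (F v.2.1 (u v.2.1)) v.1 := hnm
    rcases hum with hfull | ⟨m, htd, hdm⟩ | ⟨hver, hnar⟩
    · have hf := hf_full u' hfull
      have hv2 : v.2 = u'.2 := by rw [← hfu, hf]
      have e1 : v.1 = u'.1 + d' u'.2 := by rw [hv1, hf]
      rw [hv2, e1] at hnm'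
      exact Or.inl ⟨Or.inl hfull, by rw [hf], by rw [hf]; exact hnm'⟩
    · rcases hdm with hcr | hgl
      · -- cross along `m`
        have hf := hf_cross u' m htd hcr
        obtain ⟨h1, hfr, -, -⟩ := hspec u'.2 m htd.1.1 htd.1.2 hcr
        have hdir : F (next' u'.2 m).1 (u (next' u'.2 m).1) =
            -(F u'.2.1 (u u'.2.1) - (2 * ⟪F u'.2.1 (u u'.2.1), m⟫_ℝ) • m) := by
          rw [h1, hfr, word_u_next huc hnext_pop hnext_push, map_neg, inner_neg_left]
          module
        have htarget' : u'.1 + F (next' u'.2 m).1 (u (next' u'.2 m).1) =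
            u'.1 - (F u'.2.1 (u u'.2.1) - (2 * ⟪F u'.2.1 (u u'.2.1), m⟫_ℝ) • m) := by
          rw [hdir]; abel
        have hv2 : v.2 = next' u'.2 m := by rw [← hfu, hf]
        have e1 : v.1 = u'.1 + d' (next' u'.2 m) := by rw [hv1, hf]
        have hG : F (next' u'.2 m).1 = (F u'.2.1).trans (ℝ ∙ m)ᗮ.reflection :=
          LinearIsometryEquiv.ext fun x => by
            rw [h1, hfr, LinearIsometryEquiv.trans_apply, reflection_unit_apply htd.1.1]
        have hbq : d' (next' u'.2 m) = (u'.1 + d' (next' u'.2 m)) - u'.1 := by abel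
        refine Or.inr ⟨m, htd, hcr, by rw [hf]; exact htarget', ?_⟩
        rw [hf]
        dsimp only
        rw [hv2, e1] at hnm'
        have hnm'' : ¬ IsMoving X ver (F (next' u'.2 m).1) (d' (next' u'.2 m)) (u'.1 + d' (next' u'.2 m)) := hnm'
        rw [hG] at hnm''; rw [hbq] at hnm''
        simpa only [add_sub_cancel_left] using hnm''
      · -- glide along `m`
        have hf := hf_glide u' m htd hgl
        have hv2 : v.2 = u'.2 := by rw [← hfu, hf]
        have e1 : v.1 = u'.1 + d' u'.2 := by rw [hv1, hf]
        rw [hv2, e1] at hnm'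
        exact Or.inl ⟨Or.inr (Or.inr ⟨m, htd, hgl⟩), by rw [hf], by rw [hf]; exact hnm'⟩
    · have hf := hf_narrow u' hnar
      have hv2 : v.2 = u'.2 := by rw [← hfu, hf]
      have e1 : v.1 = u'.1 + d' u'.2 := by rw [hv1, hf]
      rw [hv2, e1] at hnm'
      exact Or.inl ⟨Or.inr (Or.inl ⟨hver, hnar⟩), by rw [hf], by rw [hf]; exact hnm'⟩

end Instance

end Summit.Ventures.Crystal3D.Theorems

end
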